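import Literature.MathematicalPhysics.QuantumLattice.GrassmannEffectiveActionBound
import HarnessLib

/-!
# The normalised partition function of one scale: `∫ dμ_C e^{-V} = exp (Σ_n 𝓔ᵀ_C(-V; n)(∅)/n!)` with a bound

Topic `Literature/MathematicalPhysics/QuantumLattice`; the degree-`0` companion of `GrassmannCumulantSeries.lean`
(`kernel_effAction_eq_neg_tsum`: the kernels of POSITIVE degree of the effective action) and of
`GrassmannEffectiveActionBound.lean` (the single-scale step).  The free energy of one integration step
(Benfatto–Giuliani–Mastropietro 2006, (2.13): the constants `L²β e_h` accumulated scale by scale; Mastropietro 2008,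
(2.36)) is the constant part of the cumulant series:

* **`effPartitionFn_eq_exp_tsum`** — for an even `V` without constant term whose cumulant series converges absolutely
  kernel by kernel, `effPartitionFn C V = exp c` with `c = Σ'_n (n!)⁻¹ constPart 𝓔ᵀ_C(-V; n)` (the exponential formula
  in the Banach algebra `⋀^{even}`, read through the continuous character `constPart`);
* **`effPartitionFn_eq_exp_of_normV`** — under the hypotheses of the single-scale step (`θ = eα‖V‖_h/κ² < 1`):
  `effPartitionFn C V = exp c` and `‖c‖ ≤ |Γ| · (κ²/α) · θ/(1 - θ)` — the free energy of one scale is extensive with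
  density `O(‖V‖_h)` (the vacuum bound `norm_constPart_cumulantOf_le_pow` summed over `n`).

Everything is proved; no definition, no named fact.

## Sources

G. Benfatto, A. Giuliani, V. Mastropietro, Ann. Henri Poincaré 7 (2006) 809–898, (2.13)–(2.14), (2.77)
(`BenfattoGiulianiMastropietro2006`); V. Mastropietro, *Non-Perturbative Renormalization* (2008), §2.3 (2.36)
(`Mastropietro2008`); K. Gawȩdzki, A. Kupiainen, Comm. Math. Phys. 102 (1985) 1–30, §3 (`GawedzkiKupiainen1985GrossNeveu`).
-/

noncomputable section

namespace Literature.MathematicalPhysics.QuantumLattice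

open GrassmannAlgebra Finset Literature.Probability.LatticeModels PowerSeries
open scoped InnerProductSpace Nat

attribute [local instance] evenPartNormedCommRing evenPartNormedAlgebra evenPart_normOneClass evenPart_completeSpace
  evenPartNormedAlgebraRat

variable {𝕜 : Type*} [RCLike 𝕜] {Γ : Type*} [Fintype Γ] [DecidableEq Γ]

/-- **The normalised partition function is the exponential of the constant part of the cumulant series**
(Benfatto–Giuliani–Mastropietro 2006, (2.13); Mastropietro 2008, (2.36)): for an even `V` without constant term whose
cumulant series `Σ_n κ_n/n!`, `κ_n = 𝓔ᵀ_C(-V; n)`, converges absolutely kernel by kernel,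
`∫ dμ_C e^{-V} = exp (Σ'_n (n!)⁻¹ constPart κ_n)`. [cite: BenfattoGiulianiMastropietro2006, (2.13)-(2.14)] -/
theorem effPartitionFn_eq_exp_tsum (C : Matrix Γ Γ 𝕜) (V : GrassmannAlgebra 𝕜 Γ) (hV : V ∈ evenPart 𝕜 Γ)
    (hV0 : constPart 𝕜 V = 0)
    (hsum : ∀ (m' : ℕ) (Y : Fin (2 * m') → Γ), Summable fun n : ℕ =>
      ‖kernel 𝕜 ((cumulantOf (fun k => evenGaussConv 𝕜 C ((⟨-V, neg_mem hV⟩ : evenPart 𝕜 Γ) ^ k)) n : evenPart 𝕜 Γ) :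
        GrassmannAlgebra 𝕜 Γ) (2 * m') Y‖ / n !) :
    effPartitionFn 𝕜 C V = NormedSpace.exp (∑' n : ℕ, (if n = 0 then 0 else
      ((n ! : 𝕜))⁻¹ * constPart 𝕜 ((cumulantOf (fun k => evenGaussConv 𝕜 C ((⟨-V, neg_mem hV⟩ : evenPart 𝕜 Γ) ^ k)) n :
        evenPart 𝕜 Γ) : GrassmannAlgebra 𝕜 Γ))) := by
  set X : evenPart 𝕜 Γ := ⟨-V, neg_mem hV⟩ with hX
  set μ : ℕ → evenPart 𝕜 Γ := fun k => evenGaussConv 𝕜 C (X ^ k) with hμ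
  have hμ0 : μ 0 = 1 := Subtype.ext (by rw [hμ]; simp only [pow_zero, coe_evenGaussConv, OneMemClass.coe_one, gaussConv_one])
  -- (1) the cumulant egf is norm-summable in the Banach algebra `⋀^{even}`
  have hK : NormSummable (egfPos (cumulantOf μ)) := by
    set w : ℕ → ℝ := fun n => (n ! : ℝ)⁻¹ * ∑ m' ∈ range (Fintype.card Γ / 2 + 1), ∑ Y : Fin (2 * m') → Γ,
      ‖kernel 𝕜 ((cumulantOf μ n : evenPart 𝕜 Γ) : GrassmannAlgebra 𝕜 Γ) (2 * m') Y‖ *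
        ‖(evenGenProd (R := 𝕜) (even_two_mul m') Y : evenPart 𝕜 Γ)‖ with hw
    have hws : Summable w := by
      have h : ∀ n, w n = ∑ m' ∈ range (Fintype.card Γ / 2 + 1), ∑ Y : Fin (2 * m') → Γ,
          ‖kernel 𝕜 ((cumulantOf μ n : evenPart 𝕜 Γ) : GrassmannAlgebra 𝕜 Γ) (2 * m') Y‖ / n ! *
            ‖(evenGenProd (R := 𝕜) (even_two_mul m') Y : evenPart 𝕜 Γ)‖ := fun n => by
        rw [hw]
        dsimp only
        rw [mul_sum]
        refine sum_congr rfl fun m' _ => ?_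
        rw [mul_sum]
        refine sum_congr rfl fun Y _ => ?_
        rw [div_eq_inv_mul]
        ring
      exact (summable_congr h).2 (summable_sum fun m' _ => summable_sum fun Y _ => (hsum m' Y).mul_right _)
    refine Summable.of_nonneg_of_le (fun n => norm_nonneg _) (fun n => ?_) hws
    rw [egfPos, coeff_egf, ← Algebra.smul_def]
    refine (norm_inv_factorial_smul_le n _).trans (mul_le_mul_of_nonneg_left ?_ (by positivity))
    split_ifs with hn
    · rw [norm_zero]
      exact sum_nonneg fun m' _ => sum_nonneg fun Y _ => by positivity
    · exact norm_le_sum_norm_kernel 𝕜 Γ _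
  -- (2) the analytic exponential formula
  obtain ⟨-, hev⟩ := tsum_egf_eq_exp_tsum_egfPos_cumulantOf μ hμ0 hK
  -- (3) `ev (egf μ)` is the finite Boltzmann sum
  have hnilV : (-V) ^ (Fintype.card Γ + 1) = 0 := pow_card_succ_eq_zero_of_constPart_eq_zero 𝕜 (by rw [map_neg, hV0, neg_zero])
  have hXpow : ∀ k, Fintype.card Γ + 1 ≤ k → X ^ k = 0 := fun k hk =>
    Subtype.ext (by rw [SubmonoidClass.coe_pow, ZeroMemClass.coe_zero]; exact pow_eq_zero_of_le hk hnilV)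
  have hμvan : ∀ k, Fintype.card Γ + 1 ≤ k → μ k = 0 := fun k hk => by
    rw [hμ]
    dsimp only
    rw [hXpow k hk, map_zero]
  have hevP : ev (egf μ) = ∑ k ∈ range (Fintype.card Γ + 1), ((k ! : ℚ)⁻¹) • μ k := by
    rw [ev, tsum_eq_sum (s := range (Fintype.card Γ + 1)) fun k hk => by
      rw [coeff_egf, hμvan k (by simpa using hk), mul_zero]]
    exact sum_congr rfl fun k _ => by rw [coeff_egf, Algebra.smul_def]
  have hBoltz : ((ev (egf μ) : evenPart 𝕜 Γ) : GrassmannAlgebra 𝕜 Γ) = effBoltzmann 𝕜 C V := by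
    rw [hevP, AddSubmonoidClass.coe_finsetSum, effBoltzmann_def, grassmannExp, IsNilpotent.exp_eq_sum hnilV, map_sum]
    refine sum_congr rfl fun k _ => ?_
    rw [coe_qsmul_evenPart, hμ]
    dsimp only
    rw [coe_evenGaussConv, SubmonoidClass.coe_pow, ← Rat.cast_smul_eq_qsmul 𝕜, map_smul]
  -- (4) the constant part is a continuous character: `Z = exp (χ S)`
  set χ : evenPart 𝕜 Γ →ₐ[𝕜] 𝕜 := (constPart 𝕜).comp (evenPart 𝕜 Γ).val with hχ
  have hχc : Continuous χ := χ.toLinearMap.continuous_of_finiteDimensional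
  have hZ : effPartitionFn 𝕜 C V = NormedSpace.exp (χ (ev (egfPos (cumulantOf μ)))) := by
    rw [effPartitionFn, ← hBoltz, hev]
    exact NormedSpace.map_exp χ hχc _
  -- (5) `χ` passes through the series
  rw [hZ, ev]
  congr 1
  have hχ' := (⟨χ.toLinearMap, hχc⟩ : evenPart 𝕜 Γ →L[𝕜] 𝕜).map_tsum hK.summable
  simp only [ContinuousLinearMap.coe_mk', AlgHom.toLinearMap_apply] at hχ'
  rw [hχ']
  refine tsum_congr fun n => ?_
  rw [egfPos, coeff_egf, map_mul]
  have hq : χ (algebraMap ℚ (evenPart 𝕜 Γ) ((n ! : ℚ)⁻¹)) = ((n ! : 𝕜))⁻¹ := by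
    rw [Algebra.algebraMap_eq_smul_one, ← Rat.cast_smul_eq_qsmul 𝕜, map_smul, map_one, smul_eq_mul, mul_one,
      Rat.cast_inv, Rat.cast_natCast]
  rw [hq]
  split_ifs with hn
  · rw [map_zero, mul_zero]
  · rfl

/-- **The free energy of one scale** (Benfatto–Giuliani–Mastropietro 2006, (2.13) with (2.77); Mastropietro 2008,
(2.36)): under the hypotheses of the single-scale step — even `V` without constant term, charged covariance in Gram
form with constant `κ`, row/column sums `≤ α`, field radius `ρ`, `θ = eα‖V‖_h/κ² < 1` — the normalised partition
function is `exp c`, `c = Σ'_n (n!)⁻¹ constPart 𝓔ᵀ_C(-V; n)`, with the EXTENSIVE bound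
`‖c‖ ≤ |Γ| · (κ²/α) · θ/(1 - θ)`. [cite: BenfattoGiulianiMastropietro2006, (2.13)-(2.14) and (2.77)-(2.80)] -/
theorem effPartitionFn_eq_exp_of_normV {E : Type*} [NormedAddCommGroup E] [InnerProductSpace 𝕜 E]
    (C : Matrix Γ Γ 𝕜) (q : Γ → Bool) (hC : ∀ X Y, q X = q Y → C X Y = 0) (f g : Γ → E) {κ : ℝ} (hκ : 0 < κ)
    (hf : ∀ X, q X = true → ‖f X‖ ≤ κ) (hg : ∀ Y, q Y = false → ‖g Y‖ ≤ κ)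
    (hG : ∀ X Y, q X = true → q Y = false → contr 𝕜 C X Y = ⟪f X, g Y⟫_𝕜)
    (V : GrassmannAlgebra 𝕜 Γ) (hV : V ∈ evenPart 𝕜 Γ) (hV0 : constPart 𝕜 V = 0) (N : ℕ → ℝ) (hN0 : ∀ m', 0 ≤ N m')
    (hN : ∀ m' (j : Fin (2 * m')) (w : Γ), ∑ Y ∈ univ.filter (fun Y : Fin (2 * m') → Γ => Y j = w), ‖kernel 𝕜 V (2 * m') Y‖ ≤ N m')
    {α : ℝ} (hα : 0 < α) (hrow : ∀ X, ∑ Y, ‖C X Y‖ ≤ α) (hcol : ∀ Y, ∑ X, ‖C X Y‖ ≤ α) {ρ : ℝ} (hρ : 0 < ρ)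
    (hθ : Real.exp 1 * α * normV Γ κ ρ N / κ ^ 2 < 1) :
    effPartitionFn 𝕜 C V = NormedSpace.exp (∑' n : ℕ, (if n = 0 then 0 else
      ((n ! : 𝕜))⁻¹ * constPart 𝕜 ((cumulantOf (fun k => evenGaussConv 𝕜 C ((⟨-V, neg_mem hV⟩ : evenPart 𝕜 Γ) ^ k)) n :
        evenPart 𝕜 Γ) : GrassmannAlgebra 𝕜 Γ))) ∧
    ‖∑' n : ℕ, (if n = 0 then (0 : 𝕜) else
      ((n ! : 𝕜))⁻¹ * constPart 𝕜 ((cumulantOf (fun k => evenGaussConv 𝕜 C ((⟨-V, neg_mem hV⟩ : evenPart 𝕜 Γ) ^ k)) n :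
        evenPart 𝕜 Γ) : GrassmannAlgebra 𝕜 Γ))‖ ≤
      (Fintype.card Γ : ℝ) * (κ ^ 2 / α) *
        ((Real.exp 1 * α * normV Γ κ ρ N / κ ^ 2) / (1 - Real.exp 1 * α * normV Γ κ ρ N / κ ^ 2)) := by
  -- notation and the cumulant bounds (as in `sum_norm_kernel_effAction_le`)
  set X : evenPart 𝕜 Γ := ⟨-V, neg_mem hV⟩ with hX
  set degs : Finset ℕ := range (Fintype.card Γ / 2 + 1) with hdegs
  set K : (m' : ℕ) → (Fin (2 * m') → Γ) → 𝕜 := fun m' => kernel 𝕜 (-V) (2 * m') with hK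
  set nV : ℝ := normV Γ κ ρ N with hnV
  set θ : ℝ := Real.exp 1 * α * nV / κ ^ 2 with hθdef
  have hnV0 : 0 ≤ nV := normV_nonneg hκ.le hρ.le hN0
  have hθ0 : 0 ≤ θ := by positivity
  have hθ1 : θ < 1 := hθ
  have hnVsum : ∑ m' ∈ degs, (Real.exp 2 * (κ + ρ)) ^ (2 * m') * N m' = nV := rfl
  have hexpn : ∀ k : ℕ, Real.exp k = Real.exp 1 ^ k := fun k => by rw [← Real.exp_nat_mul, mul_one]
  have hXv : vertexOf 𝕜 degs K = X := Subtype.ext (coe_vertexOf_kernel_eq 𝕜 X)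
  have hKnorm : ∀ (m' : ℕ) (Y : Fin (2 * m') → Γ), ‖K m' Y‖ = ‖kernel 𝕜 V (2 * m') Y‖ := by
    intro m' Y
    rw [hK]
    dsimp only
    rw [show -V = (-1 : 𝕜) • V from (neg_one_smul 𝕜 V).symm, kernel_smul, norm_mul, norm_neg, norm_one, one_mul]
  have hN' : ∀ (m' : ℕ) (j : Fin (2 * m')) (w : Γ), ∑ Y ∈ univ.filter (fun Y : Fin (2 * m') → Γ => Y j = w), ‖K m' Y‖ ≤ N m' := by
    intro m' j w
    simp only [hKnorm]
    exact hN m' j w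
  have hK0 : ∀ Y, K 0 Y = 0 := fun Y => by
    rw [hK]
    dsimp only
    rw [kernel_zero, map_neg, hV0, neg_zero]
  set κs : ℕ → evenPart 𝕜 Γ := fun n => cumulantOf (fun k => evenGaussConv 𝕜 C (X ^ k)) n with hκs
  have hκs_eq : ∀ n, κs n = cumulantOf (fun k => evenGaussConv 𝕜 C (vertexOf 𝕜 degs K ^ k)) n := fun n => by rw [hXv]
  have hbd : ∀ {n : ℕ}, 0 < n → ∀ {m : ℕ} (i : Fin m) (w : Γ),
      ∑ W ∈ univ.filter (fun W : Fin m → Γ => W i = w), ‖kernel 𝕜 ((κs n : evenPart 𝕜 Γ) : GrassmannAlgebra 𝕜 Γ) m W‖ ≤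
        (n ! : ℝ) * (ρ⁻¹ ^ m * (κ ^ 2 / α) * θ ^ n) := by
    intro n hn m i w
    have h := sum_norm_kernel_cumulantOf_le_pow C q hC f g hκ hf hg hG degs K N hN0 hN' hα hrow hcol hρ hn i w
    rw [← hκs_eq, hnVsum] at h
    refine h.trans (le_of_eq ?_)
    obtain ⟨n', rfl⟩ : ∃ n', n = n' + 1 := ⟨n - 1, by omega⟩
    rw [hθdef, hexpn, Nat.add_sub_cancel, div_pow, inv_pow, inv_pow]
    field_simp
    ring
  have hbd0 : ∀ {n : ℕ}, 0 < n → ‖constPart 𝕜 ((κs n : evenPart 𝕜 Γ) : GrassmannAlgebra 𝕜 Γ)‖ ≤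
      (n ! : ℝ) * ((Fintype.card Γ : ℝ) * (κ ^ 2 / α) * θ ^ n) := by
    intro n hn
    have h := norm_constPart_cumulantOf_le_pow C q hC f g hκ hf hg hG degs K hK0 N hN0 hN' hα hrow hcol hρ hn
    rw [← hκs_eq, hnVsum] at h
    refine h.trans (le_of_eq ?_)
    obtain ⟨n', rfl⟩ : ∃ n', n = n' + 1 := ⟨n - 1, by omega⟩
    rw [hθdef, hexpn, Nat.add_sub_cancel, div_pow, inv_pow]
    field_simp
    ring
  have hgeom : Summable fun n : ℕ => θ ^ n := summable_geometric_of_lt_one hθ0 hθ1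
  -- the kernel series converge absolutely (the hypothesis of the identification)
  have hsum : ∀ (m' : ℕ) (Y : Fin (2 * m') → Γ), Summable fun n : ℕ =>
      ‖kernel 𝕜 ((κs n : evenPart 𝕜 Γ) : GrassmannAlgebra 𝕜 Γ) (2 * m') Y‖ / n ! := by
    intro m' Y
    rw [← summable_nat_add_iff 1]
    rcases m' with _ | m'
    · refine Summable.of_nonneg_of_le (fun n => by positivity) (fun n => ?_) (hgeom.mul_left ((Fintype.card Γ : ℝ) * (κ ^ 2 / α) * θ))
      have hk : kernel 𝕜 ((κs (n + 1) : evenPart 𝕜 Γ) : GrassmannAlgebra 𝕜 Γ) (2 * 0) Y =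
          constPart 𝕜 ((κs (n + 1) : evenPart 𝕜 Γ) : GrassmannAlgebra 𝕜 Γ) := kernel_zero 𝕜 _ Y
      rw [hk, div_le_iff₀ (by positivity)]
      refine (hbd0 (n := n + 1) n.succ_pos).trans (le_of_eq ?_)
      rw [pow_succ]
      ring
    · refine Summable.of_nonneg_of_le (fun n => by positivity) (fun n => ?_) (hgeom.mul_left (ρ⁻¹ ^ (2 * (m' + 1)) * (κ ^ 2 / α) * θ))
      rw [div_le_iff₀ (by positivity)]
      have hsingle : ‖kernel 𝕜 ((κs (n + 1) : evenPart 𝕜 Γ) : GrassmannAlgebra 𝕜 Γ) (2 * (m' + 1)) Y‖ ≤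
          ∑ W ∈ univ.filter (fun W : Fin (2 * (m' + 1)) → Γ => W ⟨0, by omega⟩ = Y ⟨0, by omega⟩),
            ‖kernel 𝕜 ((κs (n + 1) : evenPart 𝕜 Γ) : GrassmannAlgebra 𝕜 Γ) (2 * (m' + 1)) W‖ :=
        single_le_sum (f := fun W => ‖kernel 𝕜 ((κs (n + 1) : evenPart 𝕜 Γ) : GrassmannAlgebra 𝕜 Γ) (2 * (m' + 1)) W‖)
          (fun W _ => norm_nonneg _) (mem_filter.2 ⟨mem_univ _, rfl⟩)
      refine (hsingle.trans (hbd (n := n + 1) n.succ_pos _ _)).trans (le_of_eq ?_)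
      rw [pow_succ]
      ring
  refine ⟨effPartitionFn_eq_exp_tsum C V hV hV0 hsum, ?_⟩
  -- the bound on the free energy
  set a : ℕ → 𝕜 := fun n => if n = 0 then 0 else
    ((n ! : 𝕜))⁻¹ * constPart 𝕜 ((κs n : evenPart 𝕜 Γ) : GrassmannAlgebra 𝕜 Γ) with ha
  have hanorm : ∀ n, ‖a n‖ ≤ (Fintype.card Γ : ℝ) * (κ ^ 2 / α) * (if n = 0 then 0 else θ ^ n) := by
    intro n
    rw [ha]
    dsimp only
    split_ifs with hn
    · rw [norm_zero, mul_zero]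
    · rw [norm_mul, norm_inv, RCLike.norm_natCast]
      calc (n ! : ℝ)⁻¹ * ‖constPart 𝕜 ((κs n : evenPart 𝕜 Γ) : GrassmannAlgebra 𝕜 Γ)‖
          ≤ (n ! : ℝ)⁻¹ * ((n ! : ℝ) * ((Fintype.card Γ : ℝ) * (κ ^ 2 / α) * θ ^ n)) :=
            mul_le_mul_of_nonneg_left (hbd0 (Nat.pos_of_ne_zero hn)) (by positivity)
        _ = (Fintype.card Γ : ℝ) * (κ ^ 2 / α) * θ ^ n := by field_simp
  have hgeom' : Summable fun n : ℕ => (Fintype.card Γ : ℝ) * (κ ^ 2 / α) * (if n = 0 then 0 else θ ^ n) := by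
    refine (hgeom.mul_left ((Fintype.card Γ : ℝ) * (κ ^ 2 / α))).of_nonneg_of_le (fun n => by positivity) fun n => ?_
    split_ifs
    · rw [mul_zero]; positivity
    · exact le_rfl
  have hsa : Summable fun n => ‖a n‖ := hgeom'.of_nonneg_of_le (fun n => norm_nonneg _) hanorm
  have htsumθ : ∑' n : ℕ, (if n = 0 then (0 : ℝ) else θ ^ n) = θ * (1 - θ)⁻¹ := by
    have hs : Summable fun n : ℕ => (if n = 0 then (0 : ℝ) else θ ^ n) :=
      hgeom.of_nonneg_of_le (fun n => by positivity) fun n => by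
        split_ifs
        · positivity
        · exact le_rfl
    rw [hs.tsum_eq_zero_add]
    simp only [if_true, Nat.succ_ne_zero, if_false, zero_add, pow_succ', tsum_mul_left, tsum_geometric_of_lt_one hθ0 hθ1]
  calc ‖∑' n, a n‖ ≤ ∑' n, ‖a n‖ := norm_tsum_le_tsum_norm hsa
    _ ≤ ∑' n, (Fintype.card Γ : ℝ) * (κ ^ 2 / α) * (if n = 0 then 0 else θ ^ n) := Summable.tsum_le_tsum hanorm hsa hgeom'
    _ = (Fintype.card Γ : ℝ) * (κ ^ 2 / α) * (θ * (1 - θ)⁻¹) := by rw [tsum_mul_left, htsumθ]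
    _ = (Fintype.card Γ : ℝ) * (κ ^ 2 / α) * (θ / (1 - θ)) := by ring

end Literature.MathematicalPhysics.QuantumLattice
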